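import Mathlib
import Summits.PneNP.PneNP.Theorems.ClusUniversalCertificateCoordDefs

/-!
# Route ClusUniversalCertificate — path `coord` on the crux `UniversalCertAll` (stmt-PneNP-19683): the BLOCK-LAYER objects (PEEL form)

Route-independent definitions file (no `Theses` import), companion of `Theorems/ClusUniversalCertificateCoordDefs.lean` (p516754, the
coordinate-peeling objects of record, namespace `…Theorems.ClusCoord`), for the PEEL form of p1's path `coord` (skeletons v7 sha16 d87d5ac2 /
v8 sha16 f469cf6a, HOME/pnp-ideate-p1/lines/layer.lean; rung F-N1, cell pnp-ideate).  VERBATIM from the skeleton, under the same Theorems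
namespace: `kemb` (the coordinates outside block `k` as an order embedding — `y ∘ kemb` deletes the whole block), `IsBLayerFamily` (a BLOCK layer
family: members cover each fibre of the block deletion with its multiplicity), `BLayerIneq` (the block layer inequality
`D(Y) ≤ Σ_S D(S) + (bsize k − 1)|Y| + 2^{bsize k} Z_k(Y)` — the `layer` line's step typed for mixed blocks), and the skeleton's sorry-free
pieces `card_filter_ne_lt` (deleting a nonempty block lowers the total dimension) and the STRONG induction on the total dimension
`ucMixDim_all_peel` with the five stub statements (`stub_cBook`, `stub_slice`, `stub_peelZeroRare`, `stub_inv`, `stub_cBookBlk`) as explicit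
hypotheses.  HONEST FRAMING: objects + sorry-free bookkeeping for an OPEN crux; the load-bearing stub `stub_peelZeroRare` is OPEN (XL);
FRONTIER rung F-N1 — nothing here bears on P vs NP.
-/

set_option linter.dupNamespace false -- `Summit.PneNP.PneNP.…`: summit = sub-problem name (D-0017 single-conjunct layout)

namespace Summit.PneNP.PneNP.Theorems.ClusCoord

open Finset

/-- the coordinates OUTSIDE block `k`, in increasing order, as an order embedding `Fin M' ↪o Fin M`
(`M'` = their number); `y ∘ kemb` deletes the whole block `k`. -/
noncomputable def kemb {M n : ℕ} (blk : Fin M → Fin n) (k : Fin n) (M' : ℕ)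
    (h : (univ.filter fun i => blk i ≠ k).card = M') : Fin M' ↪o Fin M :=
  (univ.filter fun i => blk i ≠ k).orderEmbOfFin h

/-- `L` is a BLOCK LAYER FAMILY for `(Y, k)`: each `x ∈ 𝔽₂^{M'}` lies in as many members as `Y` has points over `x` under
deletion of the whole block `k` (multiplicity ≤ `2^{bsize k}`).  This is the step of the `layer` line inside the mixed setting. -/
def IsBLayerFamily {M n : ℕ} (blk : Fin M → Fin n) (Y : Finset (Fin M → ZMod 2)) (k : Fin n) (M' : ℕ)
    (h : (univ.filter fun i => blk i ≠ k).card = M') (L : List (Finset (Fin M' → ZMod 2))) : Prop :=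
  ∀ x : Fin M' → ZMod 2, (L.filter fun S => x ∈ S).length = (Y.filter fun y => (fun j => y (kemb blk k M' h j)) = x).card

/-- the BLOCK LAYER INEQUALITY: `D(Y) ≤ Σ_{S∈L} D(S) + (bsize k − 1)·|Y| + 2^{bsize k}·Z_k(Y)` (the `layer` line's `LayerIneq`
for mixed blocks). -/
def BLayerIneq (M n : ℕ) (blk : Fin M → Fin n) (Y : Finset (Fin M → ZMod 2)) (k : Fin n) (M' : ℕ)
    (L : List (Finset (Fin M' → ZMod 2))) : Prop :=
  dsum M Y ≤ (L.map (dsum M')).sum + ((bsize blk k : ℤ) - 1) * (Y.card : ℤ) + (2 : ℤ) ^ (bsize blk k) * (zcount blk k Y : ℤ)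

/-- The block step strictly lowers the total dimension when the block is nonempty. -/
theorem card_filter_ne_lt {M n : ℕ} (blk : Fin M → Fin n) (k : Fin n) (hk : 0 < bsize blk k) :
    (univ.filter fun i => blk i ≠ k).card < M := by
  unfold bsize at hk
  obtain ⟨i, hi⟩ := Finset.card_pos.mp hk
  have hi' : blk i = k := by simpa using hi
  calc (univ.filter fun i => blk i ≠ k).card < (univ : Finset (Fin M)).card := by
        apply Finset.card_lt_card
        refine ⟨Finset.filter_subset _ _, fun hsub => ?_⟩
        have := hsub (Finset.mem_univ i)
        simp [hi'] at this
    _ = M := by simp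

/-- The induction (STRONG induction on the total dimension `M`), kernel-checked from the six structural facts:
coordinate bookkeeping, the free step, the peel conjecture on zero-rare sets, invariance, and block bookkeeping. -/
theorem ucMixDim_all_peel (h₁ : ∀ M n blk Y i L, IsCLayerFamily Y i L → CLayerIneq M n blk Y i L →
      (∀ S ∈ L, UCMix M n (blk ∘ Fin.succAbove i) S) → UCMix (M + 1) n blk Y)
    (h₂ : ∀ M (Y : Finset (Fin (M + 1) → ZMod 2)) i, IsCLayerFamily Y i [slice Y i 0, slice Y i 1] ∧
      dsum (M + 1) Y ≤ dsum M (slice Y i 0) + dsum M (slice Y i 1) + (Y.card : ℤ))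
    (h₃ : ∀ M n blk (Y : Finset (Fin (M + 1) → ZMod 2)), GZeroRare blk Y →
      ∃ g : (Fin (M + 1) → ZMod 2) ≃ₗ[ZMod 2] (Fin (M + 1) → ZMod 2), BZP blk g ∧
      ((∃ i L, IsCLayerFamily (Y.image fun y => g y) i L ∧ CLayerIneq M n blk (Y.image fun y => g y) i L) ∨
       (∃ k : Fin n, 0 < bsize blk k ∧ ∃ M' : ℕ, ∃ h : (univ.filter fun i => blk i ≠ k).card = M',
          ∃ L : List (Finset (Fin M' → ZMod 2)),
          IsBLayerFamily blk (Y.image fun y => g y) k M' h L ∧ BLayerIneq (M + 1) n blk (Y.image fun y => g y) k M' L)))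
    (h₄ : ∀ M n blk (Y : Finset (Fin M → ZMod 2)) (g : (Fin M → ZMod 2) ≃ₗ[ZMod 2] (Fin M → ZMod 2)),
      BZP blk g → UCMix M n blk (Y.image fun y => g y) → UCMix M n blk Y)
    (h₅ : ∀ M M' n blk (Y : Finset (Fin M → ZMod 2)) k (h : (univ.filter fun i => blk i ≠ k).card = M') L,
      IsBLayerFamily blk Y k M' h L → BLayerIneq M n blk Y k M' L →
      (∀ S ∈ L, UCMix M' n (blk ∘ kemb blk k M' h) S) → UCMix M n blk Y) :
    ∀ M : ℕ, UCMixDim M := by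
  intro M
  induction M using Nat.strong_induction_on with
  | _ M ih =>
    cases M with
    | zero => exact ucMixDim_zero
    | succ M =>
      intro n blk Y
      have ihM : UCMixDim M := ih M (Nat.lt_succ_self M)
      -- the free step on a set `Y'` with a coordinate `i` where `e_i` is at most as frequent as `0`
      have free : ∀ (Y' : Finset (Fin (M + 1) → ZMod 2)) (i : Fin (M + 1)),
          wcount blk i Y' ≤ zcount blk (blk i) Y' → UCMix (M + 1) n blk Y' := by
        intro Y' i hi
        obtain ⟨hfam, hloss⟩ := h₂ M Y' i
        refine h₁ M n blk Y' i [slice Y' i 0, slice Y' i 1] hfam ?_ (fun S _ => ihM n (blk ∘ Fin.succAbove i) S)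
        unfold CLayerIneq
        have hzw : ((wcount blk i Y' : ℕ) : ℤ) ≤ ((zcount blk (blk i) Y' : ℕ) : ℤ) := by exact_mod_cast hi
        have hpow : (0 : ℤ) ≤ (2 : ℤ) ^ (bsize blk (blk i) - 1) := by positivity
        have hnn := mul_nonneg hpow (sub_nonneg.mpr hzw)
        simp only [List.map_cons, List.map_nil, List.sum_cons, List.sum_nil, add_zero]
        linarith
      by_cases hfree : ∃ g : (Fin (M + 1) → ZMod 2) ≃ₗ[ZMod 2] (Fin (M + 1) → ZMod 2), BZP blk g ∧
          ∃ i : Fin (M + 1), wcount blk i (Y.image fun y => g y) ≤ zcount blk (blk i) (Y.image fun y => g y)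
      · obtain ⟨g, hg, i, hi⟩ := hfree
        exact h₄ (M + 1) n blk Y g hg (free _ i hi)
      · have hzr : GZeroRare blk Y := by
          intro g hg i
          by_contra hlt
          exact hfree ⟨g, hg, i, not_lt.mp hlt⟩
        obtain ⟨g, hg, hcases⟩ := h₃ M n blk Y hzr
        rcases hcases with ⟨i, L, hfam, hineq⟩ | ⟨k, hk, M', hM', L, hfam, hineq⟩
        · exact h₄ (M + 1) n blk Y g hg (h₁ M n blk _ i L hfam hineq (fun S _ => ihM n (blk ∘ Fin.succAbove i) S))
        · have hlt : M' < M + 1 := hM' ▸ card_filter_ne_lt blk k hk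
          exact h₄ (M + 1) n blk Y g hg
            (h₅ (M + 1) M' n blk _ k hM' L hfam hineq (fun S _ => ih M' hlt n (blk ∘ kemb blk k M' hM') S))

end Summit.PneNP.PneNP.Theorems.ClusCoord
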